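import Summits.ResolutionOfSingularities.ResolutionOfSingularities.Theorems.FrobeniusClosingSteerNestedCohenFrames
import Summits.ResolutionOfSingularities.ResolutionOfSingularities.Theorems.FrobeniusClosingSteerInsepStepChart
import Literature.AlgebraicGeometry.Resolution.AdicQuotient
import Literature.AlgebraicGeometry.Resolution.WeakJacobianDerivations
import Mathlib.RingTheory.AdicCompletion.AsTensorProduct
import Mathlib.Algebra.CharP.Subring
import HarnessLib

/-!
# Crux `Steer` (stmt-ResolutionOfSingularities-16345), chain W4.1, hGW3 / I″ KERNEL (K-I2) FILE E, part 1 of 2: THE BASIC DERIVATIONS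
# `∂_X, ∂_Y, ∂_Z : S₀ → Ŝ₁` FROM A COHEN FRAME, AND THE DESCENT IDENTITY (Theses-free, definition-free; part 2 =
# `…NonRationalStepTransversalDerivation` assembles FILE E's `exists_transversal_derivation`)

OURS (campaign `res-hironaka`, rung L ★L-G4, slot W4.1; seat res-D-pv-040 g8 on res-L0-w41-plan-1 RULING 274 (a) / 275 (c); author of the
architecture res-L0-w41-idea-3 g12: `L/res-L0-w41-idea-3/lemmaI2k/K-I2-BLUEPRINT.md` 96e1811371a42926 §1 row E / §2 E, signature file
`K-I2_signatures.lean` 6760785230e5555e §FileE — the statement of `exists_transversal_derivation` below is that signature VERBATIM;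
consumer: FILE H `…NonRationalStepNotIsolated` (I″ = `LemmaI.NonRationalStepNotIsolated d`, the `hI2` binder of stub-2's
`GeomAssembly.geomChain_false_of_pieces`); `--supports stmt-ResolutionOfSingularities-16345 --as helper`). Replaces the role of no printed item
and is NOT a statement of the manuscript under review [claim: Hironaka2017, status: under-review]; AI-produced commutative algebra over
classical inputs (Cohen structure theorem, Matsumura §28–§30), weaker than expert review; nothing here is progress on resolution of singularities in
characteristic `p` by itself.

## Setting (the K-I2 INTERFACE CONVENTION: a derivation along `ψ : B → Ŝ₁` is a bare function with the two laws)
`S₀ ≤ S₁ ⊂ L` local subrings of a field of characteristic `2`, `S₀` regular of dimension `3` with regular system of parameters `X, Y, Z`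
(`Ideal.span {X, Y, Z} = 𝔪₀`), `X ≠ 0`, the chart `B := S₀[𝔪₀/X] = S₀[Y/X, Z/X] ≤ S₁` (`blowupRing`, `LemmaI.blowupRing_eq_closure_triple`), the
local condition `𝔪₀ ⊆ 𝔪₁`, `S₁` Noetherian, `Ŝ₁ := AdicCompletion 𝔪₁ S₁`, `ψ : B → Ŝ₁` the structure map.

## What is proved
* `exists_basic_derivations` — **Stage 1**: derivations `∂₀, ∂₁, ∂₂ : S₀ → Ŝ₁` along `ι : S₀ → S₁ → Ŝ₁` with `∂ᵢ xⱼ = δᵢⱼ` for any rsop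
  `xS : Fin 3 → S₀`, and RESIDUE CONTROL `∂ᵢ c ≡ ι(s) (mod 𝔪₀Ŝ₁)`: a Cohen frame `Ŝ₀ ≅ κ⟦X₀,X₁,X₂⟧` taking `xS` to the variables
  (`NestedFrames.exists_frame_with_section`, `constantCoeff ∘ frame = residue`), the partial derivatives `MvPowerSeries.pderiv`, the canonical
  `Ŝ₀ → Ŝ₁` (`adicCompletionMap`), `𝔪̂₀ = 𝔪₀Ŝ₀` (Mathlib `AdicCompletion.maximalIdeal_eq_map`) and `κ(S₀) ↠ κ(Ŝ₀)`.
* `eq_sum_C_mul_X_pow`, `add_le_totalDegree`, `sum_coeff_mul_pow_eq_zero` (the homogenised relation `Σ c_α Y^{α₀}Z^{α₁}X^{n−|α|} = 0` in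
  `S₀` from `P(Y/X, Z/X) = 0`), **`descent_identity`** (pure algebra: if `(alg, Dp)` respects `y = x T′`, `z = x U′` letter by letter then a
  homogenised relation forces `Dp (x^n P) = 0` — two substitutions of `R[A,B,V]`, `MvPolynomial.induction_on`).
* **`exists_transversal_derivation`** (FILE E, signature VERBATIM): `∃ ∂ : B → Ŝ₁`, additive, Leibniz along `ψ`, `∂ X = 1`, `∂ (Y/X) = ∂ (Z/X) = 0`,
  and `∀ c ∈ S₀, ∃ s₀ s₁ s₂ ∈ S₀, ∂ c − ψ(s₀ + s₁·Y/X + s₂·Z/X) ∈ 𝔪₀·Ŝ₁`. Construction: `∂ := ∂₀ + ψ(Y/X)∂₁ + ψ(Z/X)∂₂` on `S₀` (so `∂ X = 1`,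
  `∂ Y = ψ(Y/X)`, `∂ Z = ψ(Z/X)`), extended to `S₀[T′,U′]` with `∂ T′ = ∂ U′ = 0` (`MvPolynomial.exists_derivation_C_eq_X_eq`), descended to `B`
  through the surjection `T′ ↦ Y/X, U′ ↦ Z/X` by `descent_identity` and the fact that `X` is a NON-ZERO-DIVISOR of `Ŝ₁` (`Ŝ₁` is flat over the
  domain `S₁`, Mathlib `AdicCompletion.flat_of_isNoetherian` + `IsSMulRegular.of_flat`; no regularity of `S₁` is used).

[cite: Matsumura1987, Thm. 28.3 (Cohen structure theorem: coefficient fields), Thm. 30.6 (derivations of power series rings)] bears_on: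
LADDER-RESOLUTION L ★L-G4 W4.1 (crux `Steer`, hGW3 at `e ≥ 3` = WORK-MODULO {I″}; I″ kernel file E of eight).
-/

noncomputable section

set_option linter.dupNamespace false

open IsLocalRing

namespace Summit.ResolutionOfSingularities.ResolutionOfSingularities.Theorems.SwitchingDichotomy.LemmaI2

open Literature.AlgebraicGeometry.Resolution
open Summit.ResolutionOfSingularities.ResolutionOfSingularities.Theorems.SwitchingDichotomy

variable {L : Type} [Field L] [CharP L 2] {S₀ S₁ : Subring L} [IsLocalRing S₀] [IsLocalRing S₁]

/-- **Stage 1: the three basic derivations `∂/∂X, ∂/∂Y, ∂/∂Z : S₀ → Ŝ₁`** along `ι : S₀ → S₁ → Ŝ₁`, read off a Cohen frame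
`Ŝ₀ ≅ κ⟦X,Y,Z⟧` (`NestedFrames.exists_frame_with_section`) and pushed along the canonical `Ŝ₀ → Ŝ₁` (`adicCompletionMap`):
additive, Leibniz along `ι`, `∂ᵢ xⱼ = δᵢⱼ`, and RESIDUE CONTROL `∂ᵢ c ≡ ι(s) (mod 𝔪₀Ŝ₁)` (only residues enter). OURS.
[cite: Matsumura1987, Thm. 28.3, Thm. 30.6] -/
theorem exists_basic_derivations (h₀₁ : S₀ ≤ S₁) (hreg₀ : IsRegularLocalRing S₀) (hdim₀ : ringKrullDim S₀ = 3)
    [IsNoetherianRing S₁] (xS : Fin 3 → S₀) (hxS : Ideal.span (Set.range xS) = maximalIdeal S₀)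
    (hdom : ∀ m : S₀, m ∈ maximalIdeal S₀ → Subring.inclusion h₀₁ m ∈ maximalIdeal S₁) :
    ∃ D : Fin 3 → S₀ → AdicCompletion (maximalIdeal S₁) S₁,
      (∀ i a b, D i (a + b) = D i a + D i b) ∧
      (∀ i a b, D i (a * b) =
        algebraMap S₁ (AdicCompletion (maximalIdeal S₁) S₁) (Subring.inclusion h₀₁ a) * D i b +
        algebraMap S₁ (AdicCompletion (maximalIdeal S₁) S₁) (Subring.inclusion h₀₁ b) * D i a) ∧
      (∀ i j, D i (xS j) = if j = i then 1 else 0) ∧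
      ∀ i c, ∃ s : S₀, D i c - algebraMap S₁ (AdicCompletion (maximalIdeal S₁) S₁) (Subring.inclusion h₀₁ s) ∈
        (maximalIdeal S₀).map ((algebraMap S₁ (AdicCompletion (maximalIdeal S₁) S₁)).comp (Subring.inclusion h₀₁)) := by
  classical
  haveI := hreg₀
  haveI : CharP S₀ 2 := inferInstance
  -- Cohen frame of `Ŝ₀`
  obtain ⟨σ, frame, -, hX, -, hcc⟩ := NestedFrames.exists_frame_with_section 2 (S := S₀) hdim₀ xS hxS
  -- the canonical map `θ : Ŝ₀ → Ŝ₁`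
  set ι : S₀ →+* AdicCompletion (maximalIdeal S₁) S₁ :=
    (algebraMap S₁ (AdicCompletion (maximalIdeal S₁) S₁)).comp (Subring.inclusion h₀₁) with hι
  have hmap : (maximalIdeal S₀).map (Subring.inclusion h₀₁) ≤ maximalIdeal S₁ :=
    Ideal.map_le_iff_le_comap.mpr fun m hm => hdom m hm
  let θ : AdicCompletion (maximalIdeal S₀) S₀ →+* AdicCompletion (maximalIdeal S₁) S₁ :=
    adicCompletionMap (maximalIdeal S₀) (maximalIdeal S₁) (Subring.inclusion h₀₁) hmap
  have hθ : ∀ a : S₀, θ (algebraMap S₀ _ a) = ι a := fun a => by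
    change adicCompletionMap _ _ _ hmap (AdicCompletion.of (maximalIdeal S₀) S₀ a) = _
    rw [adicCompletionMap_of]; rfl
  -- the derivations
  let F : S₀ →+* MvPowerSeries (Fin 3) (ResidueField (AdicCompletion (maximalIdeal S₀) S₀)) :=
    frame.toRingHom.comp (algebraMap S₀ (AdicCompletion (maximalIdeal S₀) S₀))
  let D : Fin 3 → S₀ → AdicCompletion (maximalIdeal S₁) S₁ := fun i c =>
    θ (frame.symm (MvPowerSeries.pderiv i (F c)))
  have hθF : ∀ a : S₀, θ (frame.symm (F a)) = ι a := fun a => by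
    change θ (frame.symm (frame (algebraMap S₀ _ a))) = ι a
    rw [RingEquiv.symm_apply_apply, hθ]
  refine ⟨D, fun i a b => ?_, fun i a b => ?_, fun i j => ?_, fun i c => ?_⟩
  · change θ (frame.symm (MvPowerSeries.pderiv i (F (a + b)))) = _
    rw [map_add, map_add, map_add, map_add]
  · change θ (frame.symm (MvPowerSeries.pderiv i (F (a * b)))) =
      ι a * θ (frame.symm (MvPowerSeries.pderiv i (F b))) + ι b * θ (frame.symm (MvPowerSeries.pderiv i (F a)))
    rw [map_mul, Derivation.leibniz, smul_eq_mul, smul_eq_mul, map_add, map_add, map_mul, map_mul, map_mul, map_mul,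
      hθF, hθF]
  · change θ (frame.symm (MvPowerSeries.pderiv i (frame (algebraMap S₀ _ (xS j))))) = _
    rw [hX j, MvPowerSeries.pderiv_X]
    split_ifs
    · rw [map_one, map_one]
    · rw [map_zero, map_zero]
  · -- residue control: `a := ∂ᵢ(F c)`, `k := constantCoeff a = residue (frame⁻¹ a)`, lift `k` to `s ∈ S₀`
    set b : AdicCompletion (maximalIdeal S₀) S₀ := frame.symm (MvPowerSeries.pderiv i (F c)) with hb
    obtain ⟨k', hk'⟩ := (AdicCompletion.residueField_map_bijective S₀).2 (residue _ b)
    obtain ⟨s, rfl⟩ := residue_surjective k'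
    refine ⟨s, ?_⟩
    have hbs : b - algebraMap S₀ _ s ∈ maximalIdeal (AdicCompletion (maximalIdeal S₀) S₀) := by
      rw [← Ideal.Quotient.mk_eq_mk_iff_sub_mem]
      change residue _ b = residue _ (algebraMap S₀ _ s)
      rw [← hk', ResidueField.map_residue]
    rw [AdicCompletion.maximalIdeal_eq_map] at hbs
    have himg := Ideal.mem_map_of_mem θ hbs
    rw [map_sub, hθ, Ideal.map_map] at himg
    have hcomp : θ.comp (algebraMap S₀ (AdicCompletion (maximalIdeal S₀) S₀)) = ι := RingHom.ext hθ
    rw [hcomp] at himg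
    exact himg


/-- A polynomial in two variables as the sum of its terms `c_α T^{α 0} U^{α 1}`. OURS plumbing. (folklore) -/
theorem eq_sum_C_mul_X_pow {R : Type} [CommRing R] (P : MvPolynomial (Fin 2) R) :
    P = ∑ α ∈ P.support, MvPolynomial.C (P.coeff α) * MvPolynomial.X 0 ^ (α 0) * MvPolynomial.X 1 ^ (α 1) := by
  conv_lhs => rw [P.as_sum]
  refine Finset.sum_congr rfl fun α _ => ?_
  rw [MvPolynomial.monomial_eq, Finsupp.prod_fintype _ _ (fun i => by simp), Fin.prod_univ_two, mul_assoc]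

/-- Exponents in the support are bounded by the total degree (two variables). OURS plumbing. (folklore) -/
theorem add_le_totalDegree {R : Type} [CommRing R] {P : MvPolynomial (Fin 2) R} {α : Fin 2 →₀ ℕ}
    (h : α ∈ P.support) : α 0 + α 1 ≤ P.totalDegree := by
  have := MvPolynomial.le_totalDegree h
  rwa [Finsupp.sum_fintype _ _ (fun _ => rfl), Fin.sum_univ_two] at this

omit [CharP L 2] [IsLocalRing S₀] in
/-- The homogenised relation: if `P(Y/X, Z/X) = 0` in `L` and `deg P ≤ n` then `Σ_α c_α Y^{α₀} Z^{α₁} X^{n−|α|} = 0` in `S₀`.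
OURS plumbing. (folklore) -/
theorem sum_coeff_mul_pow_eq_zero {X Y Z : S₀} (hX0 : (X : L) ≠ 0) (P : MvPolynomial (Fin 2) S₀) {n : ℕ}
    (hn : P.totalDegree ≤ n) (hP : MvPolynomial.eval₂Hom S₀.subtype ![(Y : L) / X, (Z : L) / X] P = 0) :
    ∑ α ∈ P.support, P.coeff α * Y ^ (α 0) * Z ^ (α 1) * X ^ (n - (α 0 + α 1)) = 0 := by
  have hevL : MvPolynomial.eval₂Hom S₀.subtype ![(Y : L) / X, (Z : L) / X] P =
      ∑ α ∈ P.support, ((P.coeff α : S₀) : L) * ((Y : L) / X) ^ (α 0) * ((Z : L) / X) ^ (α 1) := by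
    conv_lhs => rw [eq_sum_C_mul_X_pow P]
    rw [map_sum]
    refine Finset.sum_congr rfl fun α _ => ?_
    rw [map_mul, map_mul, map_pow, map_pow, MvPolynomial.eval₂Hom_C, MvPolynomial.eval₂Hom_X', MvPolynomial.eval₂Hom_X']
    rfl
  apply Subtype.ext
  rw [AddSubmonoidClass.coe_finsetSum, ZeroMemClass.coe_zero]
  have key : ∀ α ∈ P.support, (((P.coeff α * Y ^ (α 0) * Z ^ (α 1) * X ^ (n - (α 0 + α 1)) : S₀)) : L) =
      (X : L) ^ n * (((P.coeff α : S₀) : L) * ((Y : L) / X) ^ (α 0) * ((Z : L) / X) ^ (α 1)) := by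
    intro α hα
    have hle : α 0 + α 1 ≤ n := (add_le_totalDegree hα).trans hn
    have hXn : (X : L) ^ n = (X : L) ^ (α 0) * (X : L) ^ (α 1) * (X : L) ^ (n - (α 0 + α 1)) := by
      rw [← pow_add, ← pow_add]; congr 1; omega
    have e1 : (X : L) ^ (α 0) * ((Y : L) / X) ^ (α 0) = (Y : L) ^ (α 0) := by
      rw [div_pow, mul_comm]; exact div_mul_cancel₀ _ (pow_ne_zero _ hX0)
    have e2 : (X : L) ^ (α 1) * ((Z : L) / X) ^ (α 1) = (Z : L) ^ (α 1) := by
      rw [div_pow, mul_comm]; exact div_mul_cancel₀ _ (pow_ne_zero _ hX0)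
    rw [Subring.coe_mul, Subring.coe_mul, Subring.coe_mul, SubmonoidClass.coe_pow, SubmonoidClass.coe_pow,
      SubmonoidClass.coe_pow, hXn]
    calc ((P.coeff α : S₀) : L) * (Y : L) ^ (α 0) * (Z : L) ^ (α 1) * (X : L) ^ (n - (α 0 + α 1))
        = ((P.coeff α : S₀) : L) * ((X : L) ^ (α 0) * ((Y : L) / X) ^ (α 0)) * ((X : L) ^ (α 1) * ((Z : L) / X) ^ (α 1)) *
            (X : L) ^ (n - (α 0 + α 1)) := by rw [e1, e2]
      _ = _ := by ring
  rw [Finset.sum_congr rfl key, ← Finset.mul_sum, ← hevL, hP, mul_zero]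

/-- **The descent identity** (pure algebra). For a ring map `alg : R[T′,U′] → T` and an additive `Dp : R[T′,U′] → T` with the Leibniz
rule along `alg`, killing `T′, U′`, and compatible with the chart relations `y = x·T′`, `z = x·U′` at the level of `(alg, Dp)`:
a homogenised relation `Σ_α c_α y^{α₀} z^{α₁} x^{n−|α|} = 0` of `P` forces `Dp (x^n · P) = 0`. Proof: the substitutions
`(A,B,V) ↦ (x T′, x U′, x)` and `(A,B,V) ↦ (y, z, x)` of `R[A,B,V]` agree under `(alg, Dp)` letter by letter, hence on the
homogenisation `H` of `P`, and `ρ H = x^n P`, `ρ′ H = C 0`. OURS plumbing. (folklore) -/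
theorem descent_identity {R T : Type} [CommRing R] [CommRing T] (alg : MvPolynomial (Fin 2) R →+* T)
    (Dp : MvPolynomial (Fin 2) R → T) (hadd : ∀ P Q, Dp (P + Q) = Dp P + Dp Q)
    (hmul : ∀ P Q, Dp (P * Q) = alg P * Dp Q + alg Q * Dp P)
    (hX0 : Dp (MvPolynomial.X 0) = 0) (hX1 : Dp (MvPolynomial.X 1) = 0) {x y z : R}
    (hy : Dp (MvPolynomial.C y) = alg (MvPolynomial.X 0) * Dp (MvPolynomial.C x))
    (hz : Dp (MvPolynomial.C z) = alg (MvPolynomial.X 1) * Dp (MvPolynomial.C x))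
    (hy' : alg (MvPolynomial.C y) = alg (MvPolynomial.C x) * alg (MvPolynomial.X 0))
    (hz' : alg (MvPolynomial.C z) = alg (MvPolynomial.C x) * alg (MvPolynomial.X 1))
    (P : MvPolynomial (Fin 2) R) {n : ℕ} (hn : P.totalDegree ≤ n)
    (hrel : ∑ α ∈ P.support, P.coeff α * y ^ (α 0) * z ^ (α 1) * x ^ (n - (α 0 + α 1)) = 0) :
    Dp (MvPolynomial.C x ^ n * P) = 0 := by
  classical
  have hDp0 : Dp 0 = 0 := by
    have h := hadd 0 0
    rw [add_zero] at h
    exact (add_eq_left.mp h.symm)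
  -- the two substitutions of `R[A, B, V]`
  let ρ : MvPolynomial (Fin 3) R →+* MvPolynomial (Fin 2) R :=
    MvPolynomial.eval₂Hom MvPolynomial.C ![MvPolynomial.C x * MvPolynomial.X 0, MvPolynomial.C x * MvPolynomial.X 1, MvPolynomial.C x]
  let ρ' : MvPolynomial (Fin 3) R →+* MvPolynomial (Fin 2) R :=
    MvPolynomial.eval₂Hom MvPolynomial.C ![MvPolynomial.C y, MvPolynomial.C z, MvPolynomial.C x]
  have hρC : ∀ c, ρ (MvPolynomial.C c) = MvPolynomial.C c := fun c => MvPolynomial.eval₂Hom_C _ _ c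
  have hρ'C : ∀ c, ρ' (MvPolynomial.C c) = MvPolynomial.C c := fun c => MvPolynomial.eval₂Hom_C _ _ c
  have hρ0 : ρ (MvPolynomial.X 0) = MvPolynomial.C x * MvPolynomial.X 0 := MvPolynomial.eval₂Hom_X' _ _ 0
  have hρ1 : ρ (MvPolynomial.X 1) = MvPolynomial.C x * MvPolynomial.X 1 := MvPolynomial.eval₂Hom_X' _ _ 1
  have hρ2 : ρ (MvPolynomial.X 2) = MvPolynomial.C x := MvPolynomial.eval₂Hom_X' _ _ 2
  have hρ'0 : ρ' (MvPolynomial.X 0) = MvPolynomial.C y := MvPolynomial.eval₂Hom_X' _ _ 0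
  have hρ'1 : ρ' (MvPolynomial.X 1) = MvPolynomial.C z := MvPolynomial.eval₂Hom_X' _ _ 1
  have hρ'2 : ρ' (MvPolynomial.X 2) = MvPolynomial.C x := MvPolynomial.eval₂Hom_X' _ _ 2
  -- they agree under `(alg, Dp)` on every polynomial
  have hagree : ∀ Q : MvPolynomial (Fin 3) R, Dp (ρ Q) = Dp (ρ' Q) ∧ alg (ρ Q) = alg (ρ' Q) := by
    intro Q
    induction Q using MvPolynomial.induction_on with
    | C c => rw [hρC, hρ'C]; exact ⟨rfl, rfl⟩
    | add P Q hP hQ =>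
      exact ⟨by rw [map_add ρ, map_add ρ', hadd, hadd, hP.1, hQ.1],
        by rw [map_add ρ, map_add ρ', map_add alg, map_add alg, hP.2, hQ.2]⟩
    | mul_X Q i hQ =>
      have hXi : Dp (ρ (MvPolynomial.X i)) = Dp (ρ' (MvPolynomial.X i)) ∧
          alg (ρ (MvPolynomial.X i)) = alg (ρ' (MvPolynomial.X i)) := by
        fin_cases i
        · refine ⟨?_, ?_⟩
          · change Dp (ρ (MvPolynomial.X 0)) = Dp (ρ' (MvPolynomial.X 0))
            rw [hρ0, hρ'0, hmul, hX0, mul_zero, zero_add, hy]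
          · change alg (ρ (MvPolynomial.X 0)) = alg (ρ' (MvPolynomial.X 0))
            rw [hρ0, hρ'0, map_mul, hy']
        · refine ⟨?_, ?_⟩
          · change Dp (ρ (MvPolynomial.X 1)) = Dp (ρ' (MvPolynomial.X 1))
            rw [hρ1, hρ'1, hmul, hX1, mul_zero, zero_add, hz]
          · change alg (ρ (MvPolynomial.X 1)) = alg (ρ' (MvPolynomial.X 1))
            rw [hρ1, hρ'1, map_mul, hz']
        · refine ⟨?_, ?_⟩
          · change Dp (ρ (MvPolynomial.X 2)) = Dp (ρ' (MvPolynomial.X 2))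
            rw [hρ2, hρ'2]
          · change alg (ρ (MvPolynomial.X 2)) = alg (ρ' (MvPolynomial.X 2))
            rw [hρ2, hρ'2]
      refine ⟨?_, ?_⟩
      · rw [map_mul ρ, map_mul ρ', hmul, hmul, hQ.1, hQ.2, hXi.1, hXi.2]
      · rw [map_mul ρ, map_mul ρ', map_mul alg, map_mul alg, hQ.2, hXi.2]
  -- the homogenisation `H` of `P`
  let H : MvPolynomial (Fin 3) R := ∑ α ∈ P.support,
    MvPolynomial.C (P.coeff α) * MvPolynomial.X 0 ^ (α 0) * MvPolynomial.X 1 ^ (α 1) * MvPolynomial.X 2 ^ (n - (α 0 + α 1))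
  have hρH : ρ H = MvPolynomial.C x ^ n * P := by
    conv_rhs => rw [eq_sum_C_mul_X_pow P, Finset.mul_sum]
    change ρ (∑ α ∈ P.support, _) = _
    rw [map_sum]
    refine Finset.sum_congr rfl fun α hα => ?_
    have hle : α 0 + α 1 ≤ n := (add_le_totalDegree hα).trans hn
    rw [map_mul, map_mul, map_mul, map_pow, map_pow, map_pow, hρ0, hρ1, hρ2, hρC]
    have : (MvPolynomial.C x : MvPolynomial (Fin 2) R) ^ n =
        MvPolynomial.C x ^ (α 0) * MvPolynomial.C x ^ (α 1) * MvPolynomial.C x ^ (n - (α 0 + α 1)) := by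
      rw [← pow_add, ← pow_add]; congr 1; omega
    rw [this]; ring
  have hρ'H : ρ' H = MvPolynomial.C (∑ α ∈ P.support, P.coeff α * y ^ (α 0) * z ^ (α 1) * x ^ (n - (α 0 + α 1))) := by
    change ρ' (∑ α ∈ P.support, _) = _
    rw [map_sum, map_sum]
    refine Finset.sum_congr rfl fun α _ => ?_
    rw [map_mul, map_mul, map_mul, map_pow, map_pow, map_pow, hρ'0, hρ'1, hρ'2, hρ'C,
      map_mul, map_mul, map_mul, map_pow, map_pow, map_pow]
  rw [← hρH, (hagree H).1, hρ'H, hrel, map_zero, hDp0]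

end Summit.ResolutionOfSingularities.ResolutionOfSingularities.Theorems.SwitchingDichotomy.LemmaI2

end
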